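import Mathlib
import HarnessLib
import Summits.RiemannHypothesis.RiemannHypothesis.Theorems.IntegerScrewWalkDirichlet

/-!
# Route `IntegerScrew` — irreducibility of the truncated multiplicative walk: the kernel of the Dirichlet form is
# the constants, so `0` is a SIMPLE eigenvalue of `−walkGen M` on `ℓ²(π)` and the gap is its least non-zero eigenvalue

`IntegerScrewWalkDirichlet.dirichlet_eq_half_sum_sq` writes `E(g) = −Σ_k (g(k)/k)(walkGen·g)(k)` as a half-sum of
`(walkGen(k,j)/k)(g(j) − g(k))² ≥ 0`.  Every edge `k → kp` (`p` prime, `kp ≤ M`) has rate `log p/(p log M) > 0`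
(`walkGen_apply_mul_prime_pos`), so `E(g) = 0` forces `g(kp) = g(k)` along all such edges, and since every `n ≤ M`
descends to `1` by removing prime factors, **`E(g) = 0 ⟹ g` is constant** (`eq_apply_one_of_dirichlet_eq_zero`,
`M ≥ 2`).  With `dirichlet_nonneg` this is the min–max frame of the gap statements of `IntegerScrewWalkGap*`
(PIVOT-LAW 13.10 (iv); CONTINUUM-LIMIT 23.18 (i)).  RH-free.  Reference for the walk: M. Suzuki, J. Lond. Math.
Soc. (2) 108 (2023) 1448–1487 [Suzuki2023] (PROP. N4 of the rh-explicit A6-PIVOT programme).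
-/

noncomputable section

set_option linter.dupNamespace false -- D-0017: `Summit.<S>.<S>.…` is the designed namespace

namespace Summit.RiemannHypothesis.RiemannHypothesis.Theorems.IntegerScrew

open Finset ArithmeticFunction

/-- The birth edge `k → kp` (`p` prime, `kp ≤ M`, `M ≥ 2`) has rate `walkGen(k, kp) = log p/(p·log M) > 0`. -/
theorem walkGen_apply_mul_prime_pos {M : ℕ} (hM : 2 ≤ M) {p : ℕ} (hp : p.Prime) (k j : St M)
    (hj : (j : ℕ) = (k : ℕ) * p) : 0 < walkGen M k j := by
  have hk1 : 1 ≤ (k : ℕ) := (Finset.mem_Icc.1 k.2).1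
  have hp2 : 2 ≤ p := hp.two_le
  have hne : k ≠ j := by
    intro h
    have h1 : (k : ℕ) = (k : ℕ) * p := by rw [← hj, h]
    have h2 : (k : ℕ) * 2 ≤ (k : ℕ) * p := Nat.mul_le_mul_left _ hp2
    omega
  have hL : 0 < Real.log M := Real.log_pos (by exact_mod_cast (show 1 < M by omega))
  simp only [walkGen, if_neg hne, walkRate]
  have hne' : (k : ℕ) ≠ (j : ℕ) := fun h => hne (Subtype.ext h)
  have hdvd : (k : ℕ) ∣ (j : ℕ) := ⟨p, hj⟩
  rw [if_neg hne', if_pos hdvd, hj, Nat.mul_div_cancel_left p hk1, vonMangoldt_apply_prime hp]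
  have hp0 : (0 : ℝ) < p := by exact_mod_cast (show 0 < p by omega)
  exact div_pos (Real.log_pos (by exact_mod_cast (show 1 < p by omega))) (mul_pos hp0 hL)

/-- **Irreducibility**: if the Dirichlet energy of `g` vanishes then `g` is constant (`M ≥ 2`).  Hence `0` is a
simple eigenvalue of the `π`-self-adjoint non-negative operator `−walkGen M` (`dirichlet_nonneg`), with
eigenvector the constants, and the spectral gap is `min {E(g)/‖g‖²_π : Σ_k g(k)/k = 0, g ≠ 0} > 0`. -/
theorem eq_apply_one_of_dirichlet_eq_zero {M : ℕ} (hM : 2 ≤ M) (g : St M → ℝ)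
    (h : ∑ k : St M, g k / (k : ℕ) * ∑ j : St M, walkGen M k j * g j = 0) (k : St M) :
    g k = g ⟨1, Finset.mem_Icc.2 ⟨le_rfl, by omega⟩⟩ := by
  -- every term of the half-sum of squares vanishes
  have hsum : ∑ k : St M, ∑ j : St M, walkGen M k j / (k : ℕ) * (g j - g k) ^ 2 = 0 := by
    have e := dirichlet_eq_half_sum_sq M g
    rw [h, neg_zero] at e
    linarith
  have hterm_nonneg : ∀ k j : St M, 0 ≤ walkGen M k j / (k : ℕ) * (g j - g k) ^ 2 := by
    intro k j
    by_cases hkj : k = j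
    · subst hkj; simp
    · exact mul_nonneg (div_nonneg (walkGen_offdiag_nonneg M k j hkj) (Nat.cast_nonneg _)) (sq_nonneg _)
  have hzero : ∀ k j : St M, walkGen M k j / (k : ℕ) * (g j - g k) ^ 2 = 0 := by
    intro k j
    have h1 := (Finset.sum_eq_zero_iff_of_nonneg fun k _ =>
      Finset.sum_nonneg fun j _ => hterm_nonneg k j).1 hsum k (Finset.mem_univ _)
    exact (Finset.sum_eq_zero_iff_of_nonneg fun j _ => hterm_nonneg k j).1 h1 j (Finset.mem_univ _)
  -- along a birth edge k → kp the values agree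
  have hedge : ∀ (k j : St M) (p : ℕ), p.Prime → (j : ℕ) = (k : ℕ) * p → g j = g k := by
    intro k j p hp hj
    have hpos := walkGen_apply_mul_prime_pos hM hp k j hj
    have hk0 : (0 : ℝ) < ((k : ℕ) : ℝ) := by exact_mod_cast (Finset.mem_Icc.1 k.2).1
    have h0 := hzero k j
    rcases mul_eq_zero.1 h0 with h1 | h1
    · exact absurd h1 (div_pos hpos hk0).ne'
    · have := pow_eq_zero_iff (n := 2) (by norm_num) |>.1 h1
      linarith
  -- descend to 1 by removing prime factors (strong induction on the value)
  suffices H : ∀ n : ℕ, ∀ k : St M, (k : ℕ) = n → g k = g ⟨1, Finset.mem_Icc.2 ⟨le_rfl, by omega⟩⟩ from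
    H k k rfl
  intro n
  induction n using Nat.strong_induction_on with
  | _ n ih =>
    intro k hk
    have hk1 : 1 ≤ (k : ℕ) := (Finset.mem_Icc.1 k.2).1
    have hkM : (k : ℕ) ≤ M := (Finset.mem_Icc.1 k.2).2
    by_cases hn : n = 1
    · subst hn
      congr 1
      exact Subtype.ext hk
    · obtain ⟨p, hp, hpn⟩ := Nat.exists_prime_and_dvd (show n ≠ 1 from hn)
      obtain ⟨m, hm⟩ := hpn
      have hm1 : 1 ≤ m := by
        rcases Nat.eq_zero_or_pos m with h0 | h0
        · subst h0; omega
        · exact h0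
      have hmM : m ≤ M := by
        have : m ≤ n := by rw [hm]; exact Nat.le_mul_of_pos_left m hp.pos
        omega
      have hmlt : m < n := by
        rw [hm]
        have h2 : m * 2 ≤ p * m := by rw [mul_comm]; exact Nat.mul_le_mul_right m hp.two_le
        omega
      let m' : St M := ⟨m, Finset.mem_Icc.2 ⟨hm1, hmM⟩⟩
      have hkm : (k : ℕ) = (m' : ℕ) * p := by rw [hk, hm, mul_comm]
      rw [hedge m' k p hp hkm]
      exact ih m hmlt m' rfl

end Summit.RiemannHypothesis.RiemannHypothesis.Theorems.IntegerScrew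

end
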